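import Literature.Computability.FineGrained.ExhaustiveSatRounds
import Literature.Computability.FineGrained.FineGrainedWave0
import Literature.Computability.Complexity.TM2IterateBound
import Literature.Computability.Complexity.StringCopy
import Literature.Computability.Complexity.UnaryArithMachines
import HarnessLib

/-!
# Exhaustive search for k-SAT on `TM2`, II: the machine; `k-SAT ∈ TIME(2^n · poly(L))`

Trunk `CplxCore` / family `fine-grained`, sequel of `ExhaustiveSatRounds.lean`. Main result:

* `ExhSat.kSATInExpTime_one_of_search : ∀ k, KSATInExpTime k 1` — on Mathlib's time-bounded
  multi-stack machines (`Turing.FinTM2`), satisfiability of a `k`-CNF `φ` on `n` variables with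
  `Γ'`-encoding of length `L` (`KCNF.encode`, `FineGrainedWave0.lean`) is decided within
  `c · 2^n · (L + 1)^c` steps. This is the folklore bound "k-SAT ∈ TIME(2^n poly)" by
  exhaustive search (Impagliazzo–Paturi 2001, §1: implicit in `s_k = inf{δ : …} ≤ 1`;
  Lokshtanov–Marx–Saurabh 2011, §2), i.e. the named fact `kSATInExpTime_one` of the statement
  file, discharged in `FineGrainedWave0Proofs.lean` together with `eth_iff_satExponent_pos`.

The machine is assembled from the tree's `FinTM2` toolkit only — no machine is written by
hand — as the sequential composite (`Turing.TM2ComputableAux.comp_outputsWithin`, additive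
time) of seven stages:

0. `layFST : FST LS Γ' Sym` (`lay_eval`): from `KCNF.encode φ` to the header, the segment
   opening and the canonical body of the clause list under the empty assignment
   (`layStr`; the number of variables is dropped, the first literal becomes the pivot);
1. `codeFST` (`code_eval`): a five-bit block code `symCode` of the 24-letter loop alphabet,
   every bit doubled (`StrCopy.dup`), so that
2. `rePair` (`PairingMachines.lean`, in `FP`) appends the end marker: `rePair (dup z) = ⟨z, []⟩`
   (`StrCopy.rePair_dup`) — a transducer cannot append at the end of its input, and the loop
   string must be closed by `cpy1 cpy2 stop`;
3. `evalHdrFn (X ^ 2)` (`UnaryArithMachines.lean`, in `FP`) prefixes the unary clock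
   `hdr |z| |z|² ⟨z, []⟩`, `|z|² = (5 (litsLen + 3))² ≥ d (2 litsLen + 3)` rounds (`rounds_le`);
4. `unFST : FST US Bool (Option Sym)` (`un_eval`): skips the first unary block, turns the second
   into clock units `none`, decodes the doubled code (`symDecode`) and closes the segment at the
   end marker: the result is `replicate r none ++ (initStr cs).map some`, the input format of
5. the loop machine `TM2Iter.iterAux` of the round transducer's machine
   (`FST.timeComputable_eval roundFST`), which runs `F^[r]` on `initStr cs`
   (`TM2Iter.iterAux_outputsWithin_of_le`, with the uniform size bound
   `2 + 2^d (3 litsLen + 4)` of `search_initStr` on all iterates);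
6. `evFST : FST ES Sym Bool` (`ev_eval`, `ev_eval_canon`): evaluates every final segment (all
   literals of the occurring variables are assigned) and outputs the disjunction, which is
   `decide φ.Satisfiable` by the covering property of the final assignments
   (`decide_satisfiable_eq`).

The running time is bounded in `time_le` by `2^d · timeG L` for an explicit polynomially
bounded (`PolyBd`, `polyBd_timeG`) function `timeG` of the input length, whence
`≤ c · 2^n · (L + 1)^c` since `d ≤ n` (`card_vars_le_numVars`).

## References

* R. Impagliazzo, R. Paturi, *On the complexity of k-SAT*, JCSS 62 (2001) 367–375, §1.
  doi:10.1006/jcss.2000.1727 (not held; acq-00143).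
* D. Lokshtanov, D. Marx, S. Saurabh, *Lower bounds based on the Exponential Time Hypothesis*,
  Bull. EATCS 105 (2011) 41–72, §2 ("it is trivial to solve 3-CNF-Sat in time
  `2^n (n+m)^{O(1)}`").
* S. Arora, B. Barak, *Computational Complexity: A Modern Approach*, CUP 2009, §1.3–1.4
  (machine composition, clocked simulation).
-/

namespace Literature.Computability.FineGrained.ExhSat

open Complexity _root_.Computability Turing Polynomial

/-! ### Stage 0: laying out the initial loop string from the `Γ'`-encoding of a k-CNF -/

/-- States of the layout transducer: skipping the binary number of variables (`hd`), between
clauses (`gap`), inside a clause at the start of a literal (`inCl`), inside a literal after its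
polarity bit (`inLit`); the flag records whether a literal has been seen. [folklore] -/
inductive LS
  | hd
  | gap (pd : Bool)
  | inCl (pd : Bool)
  | inLit (pd : Bool)
  deriving DecidableEq, Fintype

/-- Whether a literal has been seen. [folklore] -/
def LS.pd : LS → Bool
  | .hd => false
  | .gap pd => pd
  | .inCl pd => pd
  | .inLit pd => pd

/-- Transition table of the layout transducer: the number of variables is dropped, brackets
become `bar`s, the polarity bit of a literal becomes its status symbol (the first literal is
the pivot, later ones are unassigned), the bits of its variable become unmarked `bit`s and its
comma the trailing flag. [folklore] -/
def layStep : LS → Γ' → LS × List Sym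
  | .hd, .comma => (.gap false, [])
  | .hd, _ => (.hd, [])
  | .gap pd, .bra => (.inCl pd, [.bar])
  | .gap pd, _ => (.gap pd, [])
  | .inCl pd, .bit b => (.inLit true, [.lit (if pd then .u else .p) b])
  | .inCl pd, .ket => (.gap pd, [])
  | .inCl pd, _ => (.inCl pd, [])
  | .inLit pd, .bit b => (.inLit pd, [.bit b false])
  | .inLit pd, .comma => (.inCl pd, [.flg false])
  | .inLit pd, _ => (.inLit pd, [])

/-- The layout transducer; its `front` is the header (mode `cmp` if some literal occurs, `done`
otherwise) and the opening of the single initial segment. [folklore] -/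
def layFST : FST LS Γ' Sym where
  init := .hd
  step := layStep
  front := fun s => [.hdr (if s.pd then .cmp else .done), .seg, .cur]
  keep := fun _ => true

/-- The step function of `layFST`. [folklore] -/
@[simp] theorem layFST_step (s : LS) (x : Γ') : layFST.step s x = layStep s x := rfl

/-- The empty partial assignment. [folklore] -/
def emptyAssg : Assg := fun _ => none

/-- The threaded cells of a clause under the empty assignment (all literals unassigned; the
first one is the pivot unless `pd`). [folklore] -/
abbrev cells₀ (pd : Bool) (cl : List Lit) : Bool × List Cell :=
  cellsG emptyAssg (fun _ => false) (fun i => unmarked (encodeNat i)) pd cl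

/-- The threaded body under the empty assignment. [folklore] -/
abbrev body₀ (pd : Bool) (cs : List (List Lit)) : Bool × Body :=
  bodyG emptyAssg (fun _ => false) (fun i => unmarked (encodeNat i)) pd cs

/-- The layout transducer skips bits in state `hd`. [folklore] -/
theorem lay_run_hd (l : List Bool) (rest : List Γ') :
    layFST.run .hd (l.map Γ'.bit ++ rest) = layFST.run .hd rest := by
  induction l with
  | nil => rfl
  | cons b l ih => simpa [FST.run_cons, layStep] using ih

/-- Inside a literal, bits are copied unmarked. [folklore] -/
theorem lay_run_inLit (pd : Bool) (l : List Bool) (rest : List Γ') :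
    layFST.run (.inLit pd) (l.map Γ'.bit ++ rest) =
      ((layFST.run (.inLit pd) rest).1, bitsStr (unmarked l) ++ (layFST.run (.inLit pd) rest).2) := by
  induction l with
  | nil => simp [bitsStr, unmarked]
  | cons b l ih =>
    simp only [List.map_cons, List.cons_append, FST.run_cons, layFST_step, layStep, ih]
    simp [bitsStr, unmarked]

/-- A literal is laid out as its cell under the empty assignment. [folklore] -/
theorem lay_run_literal (pd : Bool) (l : Lit) (rest : List Γ') :
    layFST.run (.inCl pd) (KCNF.encodeLiteral l ++ rest) =
      ((layFST.run (.inCl true) rest).1,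
        cellStr ⟨if pd then .u else .p, l.2, unmarked (encodeNat l.1), false⟩ ++
          (layFST.run (.inCl true) rest).2) := by
  simp only [KCNF.encodeLiteral, List.cons_append, List.append_assoc, FST.run_cons, layFST_step,
    layStep, lay_run_inLit]
  simp [cellStr]

/-- The literals of a clause are laid out as the threaded cells. [folklore] -/
theorem lay_run_literals (pd : Bool) (cl : List Lit) (rest : List Γ') :
    layFST.run (.inCl pd) (cl.flatMap KCNF.encodeLiteral ++ rest) =
      ((layFST.run (.inCl (cells₀ pd cl).1) rest).1,
        (cells₀ pd cl).2.flatMap cellStr ++ (layFST.run (.inCl (cells₀ pd cl).1) rest).2) := by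
  induction cl generalizing pd with
  | nil => simp [cellsG]
  | cons l cl ih =>
    rw [List.flatMap_cons, List.append_assoc, lay_run_literal, ih]
    simp [cellsG, cellG, emptyAssg]

/-- A clause is laid out as `bar` and its threaded cells. [folklore] -/
theorem lay_run_clause (pd : Bool) (cl : List Lit) (rest : List Γ') :
    layFST.run (.gap pd) (KCNF.encodeClause cl ++ rest) =
      ((layFST.run (.gap (cells₀ pd cl).1) rest).1,
        clauseStr (cells₀ pd cl).2 ++ (layFST.run (.gap (cells₀ pd cl).1) rest).2) := by
  simp only [KCNF.encodeClause, List.cons_append, List.append_assoc, FST.run_cons, layFST_step,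
    layStep, lay_run_literals]
  simp [clauseStr]

/-- The clause list is laid out as the threaded body. [folklore] -/
theorem lay_run_clauses (pd : Bool) (cs : List (List Lit)) :
    layFST.run (.gap pd) (cs.flatMap KCNF.encodeClause) =
      (.gap (body₀ pd cs).1, bodyStr (body₀ pd cs).2) := by
  induction cs generalizing pd with
  | nil => simp [bodyG, bodyStr]
  | cons cl cs ih =>
    rw [List.flatMap_cons, lay_run_clause, ih]
    simp [bodyG, bodyStr]

/-- The initial mode: `cmp` if some literal occurs, `done` otherwise. [folklore] -/
def initMode (cs : List (List Lit)) : Mode := if cs.flatten = [] then .done else .cmp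

/-- Under the empty assignment some literal is unassigned iff there is a literal. [folklore] -/
theorem hasNone_emptyAssg (ls : List Lit) : hasNone emptyAssg ls = !ls.isEmpty := by
  cases ls <;> simp [hasNone, emptyAssg]

/-- **The layout transducer** maps the encoding of a k-CNF to the header, the segment opening
and the canonical body of its clause list under the empty assignment. [folklore] -/
theorem lay_eval {k : ℕ} (φ : KCNF k) :
    layFST.eval (KCNF.encode φ) =
      Sym.hdr (initMode φ.clauses) :: Sym.seg :: Sym.cur :: bodyStr (canon emptyAssg φ.clauses) := by
  have h1 : layFST.run .hd (KCNF.encode φ) =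
      (.gap (body₀ false φ.clauses).1, bodyStr (body₀ false φ.clauses).2) := by
    rw [KCNF.encode, lay_run_hd]
    simp only [FST.run_cons, layFST_step, layStep, List.nil_append, lay_run_clauses]
  have h2 : (body₀ false φ.clauses).1 = !φ.clauses.flatten.isEmpty := by
    rw [body₀, bodyG_fst, hasNone_emptyAssg]; simp
  simp only [FST.eval]
  rw [show layFST.init = LS.hd from rfl, h1]
  change [Sym.hdr (if (LS.gap (body₀ false φ.clauses).1).pd then .cmp else .done), .seg, .cur] ++
    bodyStr (body₀ false φ.clauses).2 = _
  rw [LS.pd, h2, initMode, canon]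
  cases h : φ.clauses.flatten <;> simp

/-! ### Stage 1: binary block code of the loop alphabet, doubled -/

/-- A five-bit block code of the loop alphabet. [folklore] -/
def symCode : Sym → List Bool
  | .hdr .cmp => [false, false, false, false, false]
  | .hdr .copy => [true, false, false, false, false]
  | .hdr .fin => [false, true, false, false, false]
  | .hdr .done => [true, true, false, false, false]
  | .seg => [false, false, true, false, false]
  | .cur => [true, false, true, false, false]
  | .cpy1 => [false, true, true, false, false]
  | .cpy2 => [true, true, true, false, false]
  | .stop => [false, false, false, true, false]
  | .bar => [true, false, false, true, false]
  | .lit .u false => [false, true, false, true, false]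
  | .lit .u true => [true, true, false, true, false]
  | .lit .p false => [false, false, true, true, false]
  | .lit .p true => [true, false, true, true, false]
  | .lit (.a false) false => [false, true, true, true, false]
  | .lit (.a false) true => [true, true, true, true, false]
  | .lit (.a true) false => [false, false, false, false, true]
  | .lit (.a true) true => [true, false, false, false, true]
  | .bit false false => [false, true, false, false, true]
  | .bit false true => [true, true, false, false, true]
  | .bit true false => [false, false, true, false, true]
  | .bit true true => [true, false, true, false, true]
  | .flg false => [false, true, true, false, true]
  | .flg true => [true, true, true, false, true]

/-- The decoder of the block code (a list with the symbol, empty on non-codewords). [folklore] -/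
def symDecode : Bool → Bool → Bool → Bool → Bool → List Sym
  | false, false, false, false, false => [.hdr .cmp]
  | true, false, false, false, false => [.hdr .copy]
  | false, true, false, false, false => [.hdr .fin]
  | true, true, false, false, false => [.hdr .done]
  | false, false, true, false, false => [.seg]
  | true, false, true, false, false => [.cur]
  | false, true, true, false, false => [.cpy1]
  | true, true, true, false, false => [.cpy2]
  | false, false, false, true, false => [.stop]
  | true, false, false, true, false => [.bar]
  | false, true, false, true, false => [.lit .u false]
  | true, true, false, true, false => [.lit .u true]
  | false, false, true, true, false => [.lit .p false]
  | true, false, true, true, false => [.lit .p true]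
  | false, true, true, true, false => [.lit (.a false) false]
  | true, true, true, true, false => [.lit (.a false) true]
  | false, false, false, false, true => [.lit (.a true) false]
  | true, false, false, false, true => [.lit (.a true) true]
  | false, true, false, false, true => [.bit false false]
  | true, true, false, false, true => [.bit false true]
  | false, false, true, false, true => [.bit true false]
  | true, false, true, false, true => [.bit true true]
  | false, true, true, false, true => [.flg false]
  | true, true, true, false, true => [.flg true]
  | _, _, _, _, _ => []

/-- The code of a string: the concatenation of the codes of its symbols. [folklore] -/
def codeStr (y : List Sym) : List Bool := y.flatMap symCode

/-- Every codeword has five bits. [folklore] -/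
theorem length_symCode (x : Sym) : (symCode x).length = 5 := by
  rcases x with (_ | _ | _ | _) | _ | _ | _ | _ | _ | _ | ⟨_ | _ | (_ | _), _ | _⟩ | ⟨_ | _, _ | _⟩ | (_ | _)
    <;> rfl

/-- The code of a string of length `n` has `5 n` bits. [folklore] -/
theorem length_codeStr (y : List Sym) : (codeStr y).length = 5 * y.length := by
  induction y with
  | nil => rfl
  | cons x y ih => simp only [codeStr, List.flatMap_cons, List.length_append, length_symCode,
      List.length_cons] at ih ⊢; omega

/-- The coding transducer: emit the code of each symbol with every bit doubled. [folklore] -/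
def codeFST : FST Unit Sym Bool where
  init := ()
  step := fun _ x => ((), StrCopy.dup (symCode x))
  front := fun _ => []
  keep := fun _ => true

/-- The step function of `codeFST`. [folklore] -/
@[simp] theorem codeFST_step (u : Unit) (x : Sym) : codeFST.step u x = ((), StrCopy.dup (symCode x)) := rfl

/-- The body emitted by the coding transducer. [folklore] -/
theorem code_run (y : List Sym) : (codeFST.run () y).2 = StrCopy.dup (codeStr y) := by
  induction y with
  | nil => rfl
  | cons x y ih =>
    simp only [FST.run_cons, codeFST_step] at ih ⊢
    rw [ih]
    simp [codeStr, StrCopy.dup, List.flatMap_append]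

/-- The coding transducer computes `dup ∘ codeStr`. [folklore] -/
theorem code_eval (y : List Sym) : codeFST.eval y = StrCopy.dup (codeStr y) := by
  rw [← code_run y]
  rfl

/-! ### Stage 4: from the clocked, end-marked code to the input of the loop machine -/

/-- States of the unpacking transducer: skipping the first unary block (`skip`), converting the
second unary block into clock units (`clk`), reading the doubled code two bits at a time with
a buffer of at most four decoded bits (`rd i b₀ b₁ b₂ b₃ pend`, `i` bits buffered, `pend` the
first bit of the current pair), finished (`fin`). [folklore] -/
inductive US
  | skip
  | clk
  | r0 (pend : Option Bool)
  | r1 (b0 : Bool) (pend : Option Bool)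
  | r2 (b0 b1 : Bool) (pend : Option Bool)
  | r3 (b0 b1 b2 : Bool) (pend : Option Bool)
  | r4 (b0 b1 b2 b3 : Bool) (pend : Option Bool)
  | fin
  deriving DecidableEq, Fintype

/-- The reading state with an empty buffer. [folklore] -/
abbrev US.rd0 : US := .r0 none

/-- The symbols closing the initial segment, emitted at the end marker. [folklore] -/
def closeSeg : List (Option Sym) := [some .cpy1, some .cpy2, some .stop]

/-- Transition table of the unpacking transducer. An unequal pair (the end marker `01` of
`boolPair z []`) closes the initial segment with `cpy1 cpy2 stop`. [folklore] -/
def unStep : US → Bool → US × List (Option Sym)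
  | .skip, true => (.skip, [])
  | .skip, false => (.clk, [])
  | .clk, true => (.clk, [none])
  | .clk, false => (.rd0, [])
  | .r0 none, c => (.r0 (some c), [])
  | .r0 (some c), c' => if c = c' then (.r1 c none, []) else (.fin, closeSeg)
  | .r1 b0 none, c => (.r1 b0 (some c), [])
  | .r1 b0 (some c), c' => if c = c' then (.r2 b0 c none, []) else (.fin, closeSeg)
  | .r2 b0 b1 none, c => (.r2 b0 b1 (some c), [])
  | .r2 b0 b1 (some c), c' => if c = c' then (.r3 b0 b1 c none, []) else (.fin, closeSeg)
  | .r3 b0 b1 b2 none, c => (.r3 b0 b1 b2 (some c), [])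
  | .r3 b0 b1 b2 (some c), c' => if c = c' then (.r4 b0 b1 b2 c none, []) else (.fin, closeSeg)
  | .r4 b0 b1 b2 b3 none, c => (.r4 b0 b1 b2 b3 (some c), [])
  | .r4 b0 b1 b2 b3 (some c), c' =>
      if c = c' then (.rd0, (symDecode b0 b1 b2 b3 c).map some) else (.fin, closeSeg)
  | .fin, _ => (.fin, [])

/-- The unpacking transducer. [folklore] -/
def unFST : FST US Bool (Option Sym) where
  init := .skip
  step := unStep
  front := fun _ => []
  keep := fun _ => true

/-- The step function of `unFST`. [folklore] -/
@[simp] theorem unFST_step (s : US) (b : Bool) : unFST.step s b = unStep s b := rfl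

/-- The first unary block is skipped. [folklore] -/
theorem un_run_skip (a : ℕ) (rest : List Bool) :
    unFST.run .skip (ones a ++ false :: rest) = unFST.run .clk rest := by
  induction a with
  | zero => simp [FST.run_cons, unStep]
  | succ a ih => simpa [ones, List.replicate_succ, FST.run_cons, unStep] using ih

/-- The second unary block becomes the clock. [folklore] -/
theorem un_run_clk (r : ℕ) (rest : List Bool) :
    unFST.run .clk (ones r ++ false :: rest) =
      ((unFST.run .rd0 rest).1, List.replicate r none ++ (unFST.run .rd0 rest).2) := by
  induction r with
  | zero => simp [FST.run_cons, unStep]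
  | succ r ih =>
    simp only [ones, List.replicate_succ, List.cons_append, FST.run_cons, unFST_step, unStep] at ih ⊢
    rw [ih]
    simp

/-- A doubled codeword is decoded. [folklore] -/
theorem un_run_code (x : Sym) : unFST.run .rd0 (StrCopy.dup (symCode x)) = (.rd0, [some x]) := by
  rcases x with (_ | _ | _ | _) | _ | _ | _ | _ | _ | _ | ⟨_ | _ | (_ | _), _ | _⟩ | ⟨_ | _, _ | _⟩ | (_ | _)
    <;> rfl

/-- The doubled code of a string is decoded. [folklore] -/
theorem un_run_codeStr (y : List Sym) (rest : List Bool) :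
    unFST.run .rd0 (StrCopy.dup (codeStr y) ++ rest) =
      ((unFST.run .rd0 rest).1, y.map some ++ (unFST.run .rd0 rest).2) := by
  induction y with
  | nil => simp [codeStr, StrCopy.dup]
  | cons x y ih =>
    have hd : StrCopy.dup (codeStr (x :: y)) = StrCopy.dup (symCode x) ++ StrCopy.dup (codeStr y) := by
      simp [codeStr, StrCopy.dup, List.flatMap_append]
    rw [hd, List.append_assoc, FST.run_append, un_run_code, ih]
    simp

/-- The end marker closes the segment. [folklore] -/
theorem un_run_end : unFST.run .rd0 [false, true] = (.fin, closeSeg) := by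
  rfl

/-- **The unpacking transducer**: from `hdr a r (boolPair (codeStr y) [])` to `r` clock units
followed by `y ++ [cpy1, cpy2, stop]`. [folklore] -/
theorem un_eval (a r : ℕ) (y : List Sym) :
    unFST.eval (hdr a r (boolPair (codeStr y) [])) =
      List.replicate r none ++ (y ++ [Sym.cpy1, Sym.cpy2, Sym.stop]).map some := by
  have h : unFST.run .skip (hdr a r (boolPair (codeStr y) [])) =
      (.fin, List.replicate r none ++ (y ++ [Sym.cpy1, Sym.cpy2, Sym.stop]).map some) := by
    rw [hdr, un_run_skip, un_run_clk, StrCopy.boolPair_eq_dup, un_run_codeStr, un_run_end]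
    simp [closeSeg]
  simp only [FST.eval]
  rw [show unFST.init = US.skip from rfl, h]
  rfl

/-! ### Stage 6: evaluating the final segments -/

/-- The value of a cell: an assigned literal is true iff its value is its polarity; unassigned
and pivot cells count as false. [folklore] -/
def cellVal (c : Cell) : Bool :=
  match c.st with
  | .a v => decide (v = c.pol)
  | _ => false

/-- The value of a body: every clause has a true cell. [folklore] -/
def bodyVal (B : Body) : Bool := B.all fun cells => cells.any cellVal

/-- States of the evaluation transducer: the disjunction over the closed segments, the
conjunction over the closed clauses of the current segment, the disjunction over the cells of
the current clause. [folklore] -/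
abbrev ES : Type := Bool × Bool × Bool

/-- Transition table of the evaluation transducer (nothing is emitted). [folklore] -/
def evStep : ES → Sym → ES × List Bool
  | (acc, _, _), .seg => ((acc, true, true), [])
  | (acc, cur, cl), .bar => ((acc, cur && cl, false), [])
  | (acc, cur, cl), .lit (.a v) pol => ((acc, cur, cl || decide (v = pol)), [])
  | (acc, cur, cl), .cpy1 => ((acc || (cur && cl), cur, cl), [])
  | s, _ => (s, [])

/-- The evaluation transducer: its output is the single bit "some segment is a satisfying
assignment". [folklore] -/
def evFST : FST ES Sym Bool where
  init := (false, true, true)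
  step := evStep
  front := fun s => [s.1]
  keep := fun _ => false

/-- The step function of `evFST`. [folklore] -/
@[simp] theorem evFST_step (s : ES) (x : Sym) : evFST.step s x = evStep s x := rfl

/-- The front of `evFST` is the accumulated bit. [folklore] -/
@[simp] theorem evFST_front (s : ES) : evFST.front s = [s.1] := rfl

/-- `evFST` discards the (empty) body. [folklore] -/
@[simp] theorem evFST_keep (s : ES) : evFST.keep s = false := rfl

/-- Bits do not change the evaluation state. [folklore] -/
theorem ev_run_bits (s : ES) (bits : List (Bool × Bool)) (rest : List Sym) :
    evFST.run s (bitsStr bits ++ rest) = evFST.run s rest := by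
  induction bits with
  | nil => rfl
  | cons q bits ih =>
    obtain ⟨acc, cur, cl⟩ := s
    simpa [bitsStr, FST.run_cons, evStep] using ih

/-- A cell contributes its value to the current clause. [folklore] -/
theorem ev_run_cell (acc cur cl : Bool) (c : Cell) (rest : List Sym) :
    evFST.run (acc, cur, cl) (cellStr c ++ rest) = evFST.run (acc, cur, cl || cellVal c) rest := by
  obtain ⟨st, pol, bits, ne⟩ := c
  rcases st with _ | _ | v <;>
    simp [cellStr, FST.run_cons, evStep, ev_run_bits, cellVal]

/-- The cells of a clause contribute their disjunction. [folklore] -/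
theorem ev_run_cells (acc cur cl : Bool) (cells : List Cell) (rest : List Sym) :
    evFST.run (acc, cur, cl) (cells.flatMap cellStr ++ rest) =
      evFST.run (acc, cur, cl || cells.any cellVal) rest := by
  induction cells generalizing cl with
  | nil => simp
  | cons c cells ih => rw [List.flatMap_cons, List.append_assoc, ev_run_cell, ih]; simp [Bool.or_assoc]

/-- The fold of the evaluation state over the clauses of a body. [folklore] -/
def bodyFold : Bool → Bool → Body → Bool × Bool
  | cur, cl, [] => (cur, cl)
  | cur, cl, cells :: B => bodyFold (cur && cl) (cells.any cellVal) B

/-- A body folds the evaluation state. [folklore] -/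
theorem ev_run_body (acc cur cl : Bool) (B : Body) (rest : List Sym) :
    evFST.run (acc, cur, cl) (bodyStr B ++ rest) =
      evFST.run (acc, (bodyFold cur cl B).1, (bodyFold cur cl B).2) rest := by
  induction B generalizing cur cl with
  | nil => rfl
  | cons cells B ih =>
    simp only [bodyStr, List.flatMap_cons, List.append_assoc] at ih ⊢
    rw [clauseStr, List.cons_append, FST.run_cons, evFST_step, evStep]
    simp only [List.nil_append]
    rw [ev_run_cells, ih]
    simp [bodyFold]

/-- The folded state evaluates the body. [folklore] -/
theorem bodyFold_and (cur cl : Bool) (B : Body) :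
    ((bodyFold cur cl B).1 && (bodyFold cur cl B).2) = (cur && cl && bodyVal B) := by
  induction B generalizing cur cl with
  | nil => simp [bodyFold, bodyVal]
  | cons cells B ih =>
    rw [bodyFold, ih]
    simp only [bodyVal, List.all_cons]
    cases cur <;> cases cl <;> cases cells.any cellVal <;> simp

/-- A segment contributes the value of its body to the disjunction. [folklore] -/
theorem ev_run_seg (acc cur cl : Bool) (B : Body) (rest : List Sym) :
    evFST.run (acc, cur, cl) (segStrF (bodyStr B) ++ rest) =
      evFST.run (acc || bodyVal B, (bodyFold true true B).1, (bodyFold true true B).2) rest := by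
  simp only [segStrF, List.cons_append, List.append_assoc, FST.run_cons, evFST_step, evStep,
    List.nil_append, ev_run_body]
  have h := bodyFold_and true true B
  simp only [Bool.true_and] at h
  simp [h]

/-- The segments contribute the disjunction of their values. [folklore] -/
theorem ev_run_segs (Bs : List Body) : ∀ acc cur cl : Bool,
    (evFST.run (acc, cur, cl) ((Bs.map bodyStr).flatMap segStrF ++ [Sym.stop])).1.1 =
      (acc || Bs.any bodyVal) := by
  induction Bs with
  | nil => intro acc cur cl; simp [FST.run_cons, evStep]
  | cons B Bs ih =>
    intro acc cur cl
    rw [List.map_cons, List.flatMap_cons, List.append_assoc, ev_run_seg, ih]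
    simp [Bool.or_assoc]

/-- **The evaluation transducer** on a `done` layout outputs whether some segment body is
true. [folklore] -/
theorem ev_eval (Bs : List Body) : evFST.eval (plainStrF .done (Bs.map bodyStr)) = [Bs.any bodyVal] := by
  have h := ev_run_segs Bs false true true
  simp only [Bool.false_or] at h
  have h0 : evFST.run (false, true, true) (plainStrF .done (Bs.map bodyStr)) =
      evFST.run (false, true, true) ((Bs.map bodyStr).flatMap segStrF ++ [Sym.stop]) := by
    simp [plainStrF, FST.run_cons, evStep]
  simp only [FST.eval]
  rw [show evFST.init = (false, true, true) from rfl, h0]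
  simp [h]

/-! ### Values of canonical bodies -/

/-- The value of the clause list `cs` under the partial assignment `ρ`: every clause has a
literal made true by `ρ`. [folklore] -/
def evalA (ρ : Assg) (cs : List (List Lit)) : Bool :=
  cs.all fun cl => cl.any fun l => decide (ρ l.1 = some l.2)

/-- The value of a threaded cell is the value of its literal. [folklore] -/
theorem cellVal_cellG (ρ : Assg) (neF : ℕ → Bool) (bitsF : ℕ → List (Bool × Bool)) (pd : Bool) (l : Lit) :
    cellVal (cellG ρ neF bitsF pd l).2 = decide (ρ l.1 = some l.2) := by
  unfold cellG
  cases h : ρ l.1 with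
  | none => cases pd <;> simp [cellVal]
  | some v => simp [cellVal]

/-- The values of threaded cells. [folklore] -/
theorem any_cellVal_cellsG (ρ : Assg) (neF : ℕ → Bool) (bitsF : ℕ → List (Bool × Bool)) (pd : Bool)
    (cl : List Lit) :
    (cellsG ρ neF bitsF pd cl).2.any cellVal = cl.any fun l => decide (ρ l.1 = some l.2) := by
  induction cl generalizing pd with
  | nil => rfl
  | cons l cl ih => simp only [cellsG, List.any_cons, cellVal_cellG, ih]

/-- The value of a threaded body. [folklore] -/
theorem bodyVal_bodyG (ρ : Assg) (neF : ℕ → Bool) (bitsF : ℕ → List (Bool × Bool)) (pd : Bool)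
    (cs : List (List Lit)) : bodyVal (bodyG ρ neF bitsF pd cs).2 = evalA ρ cs := by
  induction cs generalizing pd with
  | nil => rfl
  | cons cl cs ih =>
    have ih' := ih (cellsG ρ neF bitsF pd cl).1
    simp only [bodyVal, evalA, List.all_cons] at ih ih' ⊢
    rw [bodyG]
    simp only [List.all_cons, any_cellVal_cellsG, ih']

/-- The value of the canonical body. [folklore] -/
theorem bodyVal_canon (ρ : Assg) (cs : List (List Lit)) : bodyVal (canon ρ cs) = evalA ρ cs :=
  bodyVal_bodyG ρ _ _ false cs

/-- **Correctness of the search**: for a list of assignments which are total on the occurring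
literals and cover all total assignments, the formula is satisfiable iff some assignment of the
list makes it true. [folklore] -/
theorem decide_satisfiable_eq {k : ℕ} (φ : KCNF k) (ρs : List Assg) (hcov : Cov ρs)
    (htot : ∀ ρ ∈ ρs, ∀ l ∈ φ.clauses.flatten, ρ l.1 ≠ none) :
    decide φ.Satisfiable = ρs.any fun ρ => evalA ρ φ.clauses := by
  rw [Bool.eq_iff_iff, decide_eq_true_iff, List.any_eq_true]
  constructor
  · rintro ⟨v, hv⟩
    set σ : ℕ → Bool := fun i => if h : i < φ.numVars then v ⟨i, h⟩ else false with hσ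
    obtain ⟨ρ, hρ, hag⟩ := hcov σ
    refine ⟨ρ, hρ, ?_⟩
    simp only [KCNF.eval, List.all_eq_true, List.any_eq_true, beq_iff_eq] at hv
    simp only [evalA, List.all_eq_true, List.any_eq_true, decide_eq_true_eq]
    intro cl hcl
    obtain ⟨l, hl, hval⟩ := hv cl hcl
    refine ⟨l, hl, ?_⟩
    have hne := htot ρ hρ l (List.mem_flatten.2 ⟨cl, hcl, hl⟩)
    obtain ⟨b, hb⟩ := Option.ne_none_iff_exists'.1 hne
    rw [hb]
    exact congrArg some (((hag l.1 b hb).symm).trans hval)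
  · rintro ⟨ρ, hρ, hval⟩
    refine ⟨fun i => (ρ i.1).getD false, ?_⟩
    simp only [KCNF.eval, List.all_eq_true, List.any_eq_true, beq_iff_eq]
    simp only [evalA, List.all_eq_true, List.any_eq_true, decide_eq_true_eq] at hval
    intro cl hcl
    obtain ⟨l, hl, hρl⟩ := hval cl hcl
    refine ⟨l, hl, ?_⟩
    have hlt : l.1 < φ.numVars := φ.fst_lt_numVars cl hcl l hl
    simp [hlt, hρl]

/-! ### The whole search from the initial loop string -/

/-- The initial loop string of a clause list: the header, one segment with the canonical body
of the empty assignment, the terminator. [folklore] -/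
def initStr (cs : List (List Lit)) : List Sym :=
  plainStrF (initMode cs) [bodyStr (canon emptyAssg cs)]

/-- The initial loop string, spelled out. [folklore] -/
theorem initStr_eq (cs : List (List Lit)) :
    initStr cs = (Sym.hdr (initMode cs) :: Sym.seg :: Sym.cur :: bodyStr (canon emptyAssg cs)) ++
      [Sym.cpy1, Sym.cpy2, Sym.stop] := by
  simp [initStr, plainStrF, segStrF]

/-- Length of the initial loop string. [folklore] -/
theorem length_initStr (cs : List (List Lit)) : (initStr cs).length = litsLen cs + 6 := by
  rw [initStr_eq]; simp [length_canon]

/-- There is no occurring variable iff there is no literal. [folklore] -/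
theorem vars_eq_empty_iff (cs : List (List Lit)) : vars cs = ∅ ↔ cs.flatten = [] := by
  simp [vars, List.toFinset_eq_empty_iff]

/-- The empty assignment has empty domain. [folklore] -/
theorem sameDom_emptyAssg : SameDom ∅ emptyAssg := fun i => by simp [emptyAssg]

/-- The singleton list of the empty assignment covers every total assignment. [folklore] -/
theorem cov_emptyAssg : Cov [emptyAssg] := fun σ => ⟨emptyAssg, by simp, fun i v h => by simp [emptyAssg] at h⟩

/-- A `done` layout is fixed by all further rounds. [folklore] -/
theorem iterate_F_done (n : ℕ) (ss : List (List Sym)) : F^[n] (plainStrF .done ss) = plainStrF .done ss :=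
  Function.iterate_fixed (F_done _) n

/-- **The search from the initial loop string.** After any number `R ≥ d (2 litsLen cs + 3)` of
rounds (`d` the number of occurring variables) the loop string is the `done` layout of the
canonical segments of a list of assignments, total on the occurring literals and covering all
total assignments; no intermediate string is longer than `2 + 2^d (3 litsLen cs + 4)`.
[folklore] -/
theorem search_initStr (cs : List (List Lit)) : ∃ ρsF : List Assg,
    (∀ R, (vars cs).card * (2 * litsLen cs + 3) ≤ R →
      F^[R] (initStr cs) = plainStrF .done (ρsF.map fun ρ => bodyStr (canon ρ cs))) ∧
    (∀ ρ ∈ ρsF, ∀ l ∈ cs.flatten, ρ l.1 ≠ none) ∧ Cov ρsF ∧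
    ∀ i, (F^[i] (initStr cs)).length ≤ 2 + 2 ^ (vars cs).card * (3 * litsLen cs + 4) := by
  rcases Nat.eq_zero_or_pos (vars cs).card with hd | hd
  · -- no occurring variable: the initial string is already `done`
    have hfl : cs.flatten = [] := (vars_eq_empty_iff cs).1 (Finset.card_eq_zero.1 hd)
    have hS : initStr cs = plainStrF .done ([emptyAssg].map fun ρ => bodyStr (canon ρ cs)) := by
      simp [initStr, initMode, hfl]
    refine ⟨[emptyAssg], fun R _ => by rw [hS, iterate_F_done], by simp [hfl], cov_emptyAssg, fun i => ?_⟩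
    rw [hS, iterate_F_done, ← hS, length_initStr, hd]
    omega
  · -- at least one occurring variable: `search`
    have hfl : cs.flatten ≠ [] := fun h => by
      rw [← vars_eq_empty_iff] at h
      rw [h, Finset.card_empty] at hd
      exact lt_irrefl 0 hd
    obtain ⟨R₁, hR₁, ρsF, hF, hlen, htot, hcov, hbd⟩ :=
      search (cs := cs) (vars cs).card ∅ [emptyAssg] (by simp) (fun ρ hρ => by
        simp only [List.mem_singleton] at hρ; subst hρ; exact sameDom_emptyAssg) (by simp) hd
    have hS : initStr cs = plainStrF .cmp ([emptyAssg].map fun ρ => bodyStr (canon ρ cs)) := by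
      simp [initStr, initMode, hfl]
    simp only [List.map_cons, List.map_nil, List.length_singleton, Nat.mul_one] at hF hbd hlen hS
    refine ⟨ρsF, fun R hR => ?_, htot, hcov cov_emptyAssg, fun i => ?_⟩
    · obtain ⟨j, rfl⟩ : ∃ j, R = j + R₁ := ⟨R - R₁, by omega⟩
      rw [Function.iterate_add_apply, hS, hF, iterate_F_done]
    · rcases le_or_gt i R₁ with hi | hi
      · rw [hS]; exact hbd i hi
      · obtain ⟨j, rfl⟩ : ∃ j, i = j + R₁ := ⟨i - R₁, by omega⟩
        rw [Function.iterate_add_apply, hS, hF, iterate_F_done,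
          length_plainStrF _ _ (litsLen cs) (by
            intro s hs; simp only [List.mem_map] at hs; obtain ⟨ρ, -, rfl⟩ := hs; exact length_canon ρ cs),
          List.length_map, hlen]
        have h4 : litsLen cs + 4 ≤ 3 * litsLen cs + 4 := by omega
        have := Nat.mul_le_mul_left (2 ^ (vars cs).card) h4
        omega

/-! ### Polynomially bounded functions -/

/-- `PolyBd f`: `f n ≤ c · (n + 1)^c` for some constant `c`. [folklore] -/
def PolyBd (f : ℕ → ℕ) : Prop := ∃ c : ℕ, ∀ n, f n ≤ c * (n + 1) ^ c

namespace PolyBd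

/-- A function below a polynomially bounded one is polynomially bounded. [folklore] -/
theorem of_le {f g : ℕ → ℕ} (hf : PolyBd f) (h : ∀ n, g n ≤ f n) : PolyBd g := by
  obtain ⟨c, hc⟩ := hf
  exact ⟨c, fun n => (h n).trans (hc n)⟩

/-- Linear functions are polynomially bounded. [folklore] -/
theorem linear (a b : ℕ) : PolyBd fun n => a * n + b := by
  refine ⟨a + b, fun n => ?_⟩
  have h1 : n + 1 ≤ (n + 1) ^ (a + b) ∨ a + b = 0 := by
    rcases Nat.eq_zero_or_pos (a + b) with h | h
    · exact Or.inr h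
    · exact Or.inl (by simpa using Nat.pow_le_pow_right (Nat.succ_pos n) h)
  rcases h1 with h1 | h1
  · nlinarith
  · have ha : a = 0 := by omega
    have hb : b = 0 := by omega
    subst ha; subst hb; simp

/-- Constants are polynomially bounded. [folklore] -/
theorem const (a : ℕ) : PolyBd fun _ => a := by simpa using linear 0 a

/-- The identity is polynomially bounded. [folklore] -/
theorem id' : PolyBd fun n => n := by simpa using linear 1 0

/-- Sums of polynomially bounded functions are polynomially bounded. [folklore] -/
theorem add {f g : ℕ → ℕ} (hf : PolyBd f) (hg : PolyBd g) : PolyBd fun n => f n + g n := by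
  obtain ⟨c, hc⟩ := hf
  obtain ⟨d, hd⟩ := hg
  refine ⟨c + d, fun n => ?_⟩
  have h1 : (n + 1) ^ c ≤ (n + 1) ^ (c + d) := Nat.pow_le_pow_right (Nat.succ_pos n) (by omega)
  have h2 : (n + 1) ^ d ≤ (n + 1) ^ (c + d) := Nat.pow_le_pow_right (Nat.succ_pos n) (by omega)
  calc f n + g n ≤ c * (n + 1) ^ c + d * (n + 1) ^ d := Nat.add_le_add (hc n) (hd n)
    _ ≤ c * (n + 1) ^ (c + d) + d * (n + 1) ^ (c + d) :=
        Nat.add_le_add (Nat.mul_le_mul_left c h1) (Nat.mul_le_mul_left d h2)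
    _ = (c + d) * (n + 1) ^ (c + d) := by ring

/-- Products of polynomially bounded functions are polynomially bounded. [folklore] -/
theorem mul {f g : ℕ → ℕ} (hf : PolyBd f) (hg : PolyBd g) : PolyBd fun n => f n * g n := by
  obtain ⟨c, hc⟩ := hf
  obtain ⟨d, hd⟩ := hg
  refine ⟨c * d + c + d, fun n => ?_⟩
  have h1 : (n + 1) ^ (c + d) ≤ (n + 1) ^ (c * d + c + d) :=
    Nat.pow_le_pow_right (Nat.succ_pos n) (by omega)
  calc f n * g n ≤ (c * (n + 1) ^ c) * (d * (n + 1) ^ d) := Nat.mul_le_mul (hc n) (hd n)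
    _ = (c * d) * (n + 1) ^ (c + d) := by ring
    _ ≤ (c * d + c + d) * (n + 1) ^ (c * d + c + d) := Nat.mul_le_mul (by omega) h1

/-- Powers of a polynomially bounded function are polynomially bounded. [folklore] -/
theorem pow {f : ℕ → ℕ} (hf : PolyBd f) (k : ℕ) : PolyBd fun n => f n ^ k := by
  induction k with
  | zero => simpa using linear 0 1
  | succ k ih => simpa [pow_succ] using ih.mul hf

/-- A polynomial of a polynomially bounded function is polynomially bounded. [folklore] -/
theorem poly {f : ℕ → ℕ} (p : Polynomial ℕ) (hf : PolyBd f) : PolyBd fun n => p.eval (f n) := by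
  induction p using Polynomial.induction_on' with
  | add p q hp hq => simpa using hp.add hq
  | monomial k a =>
    simpa [Polynomial.eval_monomial] using (linear 0 a).mul (hf.pow k)

end PolyBd

/-! ### Size facts -/

/-- Length of the encoding of the literals of a clause. [folklore] -/
theorem length_flatMap_encodeLiteral (cl : List Lit) :
    (cl.flatMap KCNF.encodeLiteral).length = (cl.map fun l => (encodeNat l.1).length + 2).sum := by
  induction cl with
  | nil => rfl
  | cons l cl ih => simp [KCNF.encodeLiteral, ih]; omega

/-- `litsLen` of a cons. [folklore] -/
theorem litsLen_cons (cl : List Lit) (cs : List (List Lit)) :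
    litsLen (cl :: cs) = (1 + (cl.map fun l => (encodeNat l.1).length + 2).sum) + litsLen cs := by
  simp [litsLen]

/-- `litsLen` of the empty clause list. [folklore] -/
@[simp] theorem litsLen_nil : litsLen [] = 0 := rfl

/-- The canonical body is shorter than the encoded clause list. [folklore] -/
theorem litsLen_le_length_flatMap (cs : List (List Lit)) :
    litsLen cs ≤ (cs.flatMap KCNF.encodeClause).length := by
  induction cs with
  | nil => simp
  | cons cl cs ih =>
    rw [litsLen_cons, List.flatMap_cons, List.length_append]
    have : (KCNF.encodeClause cl).length = (cl.map fun l => (encodeNat l.1).length + 2).sum + 2 := by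
      rw [KCNF.encodeClause, List.cons_append, List.length_cons, List.length_append,
        length_flatMap_encodeLiteral]
      simp
    omega

/-- The canonical body is shorter than the input. [folklore] -/
theorem litsLen_le_length_encode {k : ℕ} (φ : KCNF k) : litsLen φ.clauses ≤ φ.encode.length := by
  have := litsLen_le_length_flatMap φ.clauses
  simp only [KCNF.encode, List.length_append, List.length_cons, List.length_map]
  omega

/-- There are at most `litsLen` literals. [folklore] -/
theorem length_flatten_le_litsLen (cs : List (List Lit)) : cs.flatten.length ≤ litsLen cs := by
  induction cs with
  | nil => simp
  | cons cl cs ih =>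
    rw [litsLen_cons, List.flatten_cons, List.length_append]
    have : cl.length ≤ (cl.map fun l => (encodeNat l.1).length + 2).sum := by
      have h : ∀ cl : List Lit, cl.length ≤ (cl.map fun l => (encodeNat l.1).length + 2).sum := by
        intro cl; induction cl with
        | nil => simp
        | cons l cl ih => simp only [List.length_cons, List.map_cons, List.sum_cons]; omega
      exact h cl
    omega

/-- The number of occurring variables is at most `litsLen`. [folklore] -/
theorem card_vars_le_litsLen (cs : List (List Lit)) : (vars cs).card ≤ litsLen cs := by
  refine le_trans ?_ (length_flatten_le_litsLen cs)
  have h := List.toFinset_card_le (cs.flatten.map Prod.fst)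
  rw [List.length_map] at h
  exact h

/-- The number of occurring variables is at most the number of variables. [folklore] -/
theorem card_vars_le_numVars {k : ℕ} (φ : KCNF k) : (vars φ.clauses).card ≤ φ.numVars := by
  have h : vars φ.clauses ⊆ Finset.range φ.numVars := by
    intro i hi
    simp only [vars, List.mem_toFinset, List.mem_map, List.mem_flatten] at hi
    obtain ⟨l, ⟨cl, hcl, hl⟩, rfl⟩ := hi
    exact Finset.mem_range.2 (φ.fst_lt_numVars cl hcl l hl)
  simpa using Finset.card_le_card h

/-! ### The time bound -/

/-- The polynomial factor of the running time, as a function of the input length `ℓ`, in terms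
of the emission bounds of the four transducers and of the round transducer and of the time
polynomials of the two `FP` stages. [folklore] -/
noncomputable def timeG (E₀ E₁ E₄ EF E₆ : ℕ) (p₂ p₃ : Polynomial ℕ) (ℓ : ℕ) : ℕ :=
  ((E₀ + 1) * ℓ + 3) + ((E₁ + 1) * (ℓ + 3) + 3) + p₂.eval (10 * (ℓ + 3)) +
    p₃.eval (10 * (ℓ + 3) + 2) +
    ((E₄ + 1) * (5 * (ℓ + 3) + (5 * (ℓ + 3)) ^ 2 + (10 * (ℓ + 3) + 2) + 2) + 3) +
    (2 * (ℓ + 6) + (5 * (ℓ + 3)) ^ 2 + 4 +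
      (5 * (ℓ + 3)) ^ 2 * (2 * (3 * ℓ + 6) + 3 + ((EF + 1) * (3 * ℓ + 6) + 3))) +
    ((E₆ + 1) * (3 * ℓ + 6) + 3)

/-- The polynomial factor is polynomially bounded. [folklore] -/
theorem polyBd_timeG (E₀ E₁ E₄ EF E₆ : ℕ) (p₂ p₃ : Polynomial ℕ) :
    PolyBd (timeG E₀ E₁ E₄ EF E₆ p₂ p₃) := by
  have l3 : PolyBd fun ℓ => ℓ + 3 := PolyBd.id'.add (PolyBd.const 3)
  have l6 : PolyBd fun ℓ => ℓ + 6 := PolyBd.id'.add (PolyBd.const 6)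
  have l5 : PolyBd fun ℓ => 5 * (ℓ + 3) := (PolyBd.const 5).mul l3
  have sq : PolyBd fun ℓ => (5 * (ℓ + 3)) ^ 2 := l5.pow 2
  have l36 : PolyBd fun ℓ => 3 * ℓ + 6 := PolyBd.linear 3 6
  have l10 : PolyBd fun ℓ => 10 * (ℓ + 3) := (PolyBd.const 10).mul l3
  have hG0 : PolyBd fun ℓ => (E₀ + 1) * ℓ + 3 := PolyBd.linear _ _
  have hG1 : PolyBd fun ℓ => (E₁ + 1) * (ℓ + 3) + 3 := ((PolyBd.const _).mul l3).add (PolyBd.const 3)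
  have hG2 : PolyBd fun ℓ => p₂.eval (10 * (ℓ + 3)) := PolyBd.poly p₂ l10
  have hG3 : PolyBd fun ℓ => p₃.eval (10 * (ℓ + 3) + 2) := PolyBd.poly p₃ (l10.add (PolyBd.const 2))
  have hG4 : PolyBd fun ℓ => (E₄ + 1) * (5 * (ℓ + 3) + (5 * (ℓ + 3)) ^ 2 + (10 * (ℓ + 3) + 2) + 2) + 3 :=
    ((PolyBd.const _).mul (((l5.add sq).add (l10.add (PolyBd.const 2))).add (PolyBd.const 2))).add
      (PolyBd.const 3)
  have hG5 : PolyBd fun ℓ => 2 * (ℓ + 6) + (5 * (ℓ + 3)) ^ 2 + 4 +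
      (5 * (ℓ + 3)) ^ 2 * (2 * (3 * ℓ + 6) + 3 + ((EF + 1) * (3 * ℓ + 6) + 3)) :=
    ((((PolyBd.const 2).mul l6).add sq).add (PolyBd.const 4)).add
      (sq.mul ((((PolyBd.const 2).mul l36).add (PolyBd.const 3)).add
        (((PolyBd.const _).mul l36).add (PolyBd.const 3))))
  have hG6 : PolyBd fun ℓ => (E₆ + 1) * (3 * ℓ + 6) + 3 := ((PolyBd.const _).mul l36).add (PolyBd.const 3)
  exact (((((hG0.add hG1).add hG2).add hG3).add hG4).add hG5).add hG6

/-- **The arithmetic of the time bound**: the sum of the stage times is at most `2^d · timeG ℓ`.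
[folklore] -/
theorem time_le (E₀ E₁ E₄ EF E₆ : ℕ) (p₂ p₃ : Polynomial ℕ) {m ℓ d Lf : ℕ} (hm : m ≤ ℓ)
    (hLf : Lf ≤ 2 + 2 ^ d * (3 * m + 4)) :
    ((E₆ + 1) * Lf + 3) +
      ((2 * (m + 6) + (5 * (m + 3)) ^ 2 + 4 + (5 * (m + 3)) ^ 2 *
          (2 * (2 + 2 ^ d * (3 * m + 4)) + 3 + ((EF + 1) * (2 + 2 ^ d * (3 * m + 4)) + 3))) +
        (((E₄ + 1) * (5 * (m + 3) + (5 * (m + 3)) ^ 2 + (10 * (m + 3) + 2) + 2) + 3) +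
          (p₃.eval (10 * (m + 3) + 2) + (p₂.eval (10 * (m + 3)) +
            (((E₁ + 1) * (m + 3) + 3) + ((E₀ + 1) * ℓ + 3)))))) ≤
      2 ^ d * timeG E₀ E₁ E₄ EF E₆ p₂ p₃ ℓ := by
  have hD : 1 ≤ 2 ^ d := Nat.one_le_two_pow
  set D := 2 ^ d with hDdef
  -- the exponential-free stages
  have t0 : (E₀ + 1) * ℓ + 3 ≤ D * ((E₀ + 1) * ℓ + 3) := Nat.le_mul_of_pos_left _ hD
  have t1 : (E₁ + 1) * (m + 3) + 3 ≤ D * ((E₁ + 1) * (ℓ + 3) + 3) :=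
    le_trans (by nlinarith) (Nat.le_mul_of_pos_left _ hD)
  have t2 : p₂.eval (10 * (m + 3)) ≤ D * p₂.eval (10 * (ℓ + 3)) :=
    le_trans (TM2Iter.eval_mono p₂ (by omega)) (Nat.le_mul_of_pos_left _ hD)
  have t3 : p₃.eval (10 * (m + 3) + 2) ≤ D * p₃.eval (10 * (ℓ + 3) + 2) :=
    le_trans (TM2Iter.eval_mono p₃ (by omega)) (Nat.le_mul_of_pos_left _ hD)
  have hsq : (5 * (m + 3)) ^ 2 ≤ (5 * (ℓ + 3)) ^ 2 := Nat.pow_le_pow_left (by omega) 2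
  have t4 : (E₄ + 1) * (5 * (m + 3) + (5 * (m + 3)) ^ 2 + (10 * (m + 3) + 2) + 2) + 3 ≤
      D * ((E₄ + 1) * (5 * (ℓ + 3) + (5 * (ℓ + 3)) ^ 2 + (10 * (ℓ + 3) + 2) + 2) + 3) :=
    le_trans (by nlinarith) (Nat.le_mul_of_pos_left _ hD)
  -- the loop and the evaluation
  have hB : 2 + D * (3 * m + 4) ≤ D * (3 * ℓ + 6) := by nlinarith
  have t5a : 2 * (m + 6) + (5 * (m + 3)) ^ 2 + 4 ≤ D * (2 * (ℓ + 6) + (5 * (ℓ + 3)) ^ 2 + 4) :=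
    le_trans (by omega) (Nat.le_mul_of_pos_left _ hD)
  have t5b : 2 * (2 + D * (3 * m + 4)) + 3 + ((EF + 1) * (2 + D * (3 * m + 4)) + 3) ≤
      D * (2 * (3 * ℓ + 6) + 3 + ((EF + 1) * (3 * ℓ + 6) + 3)) := by
    have := Nat.mul_le_mul_left (EF + 1) hB
    nlinarith
  have t5c : (5 * (m + 3)) ^ 2 * (2 * (2 + D * (3 * m + 4)) + 3 + ((EF + 1) * (2 + D * (3 * m + 4)) + 3)) ≤
      D * ((5 * (ℓ + 3)) ^ 2 * (2 * (3 * ℓ + 6) + 3 + ((EF + 1) * (3 * ℓ + 6) + 3))) := by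
    calc _ ≤ (5 * (ℓ + 3)) ^ 2 * (D * (2 * (3 * ℓ + 6) + 3 + ((EF + 1) * (3 * ℓ + 6) + 3))) :=
          Nat.mul_le_mul hsq t5b
      _ = _ := by ring
  have t6 : (E₆ + 1) * Lf + 3 ≤ D * ((E₆ + 1) * (3 * ℓ + 6) + 3) := by
    have h1 : (E₆ + 1) * Lf ≤ (E₆ + 1) * (D * (3 * ℓ + 6)) := Nat.mul_le_mul_left _ (hLf.trans hB)
    nlinarith
  calc _ ≤ D * ((E₆ + 1) * (3 * ℓ + 6) + 3) +
        ((D * (2 * (ℓ + 6) + (5 * (ℓ + 3)) ^ 2 + 4) +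
          D * ((5 * (ℓ + 3)) ^ 2 * (2 * (3 * ℓ + 6) + 3 + ((EF + 1) * (3 * ℓ + 6) + 3)))) +
        (D * ((E₄ + 1) * (5 * (ℓ + 3) + (5 * (ℓ + 3)) ^ 2 + (10 * (ℓ + 3) + 2) + 2) + 3) +
          (D * p₃.eval (10 * (ℓ + 3) + 2) + (D * p₂.eval (10 * (ℓ + 3)) +
            (D * ((E₁ + 1) * (ℓ + 3) + 3) + D * ((E₀ + 1) * ℓ + 3)))))) :=
        Nat.add_le_add t6 (Nat.add_le_add (Nat.add_le_add t5a t5c)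
          (Nat.add_le_add t4 (Nat.add_le_add t3 (Nat.add_le_add t2 (Nat.add_le_add t1 t0)))))
    _ = D * timeG E₀ E₁ E₄ EF E₆ p₂ p₃ ℓ := by unfold timeG; ring

/-! ### The intermediate strings and their lengths -/

/-- The laid-out string of a clause list: header, segment opening, canonical body of the empty
assignment. [folklore] -/
def layStr (cs : List (List Lit)) : List Sym :=
  Sym.hdr (initMode cs) :: Sym.seg :: Sym.cur :: bodyStr (canon emptyAssg cs)

/-- The layout transducer computes `layStr`. [folklore] -/
theorem lay_eval' {k : ℕ} (φ : KCNF k) : layFST.eval φ.encode = layStr φ.clauses := lay_eval φ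

/-- Closing the laid-out string gives the initial loop string. [folklore] -/
theorem layStr_append (cs : List (List Lit)) :
    layStr cs ++ [Sym.cpy1, Sym.cpy2, Sym.stop] = initStr cs := (initStr_eq cs).symm

/-- Length of the laid-out string. [folklore] -/
theorem length_layStr (cs : List (List Lit)) : (layStr cs).length = litsLen cs + 3 := by
  simp [layStr, length_canon]

/-- Length of a doubled string. [folklore] -/
theorem length_dup (l : List Bool) : (StrCopy.dup l).length = 2 * l.length := by
  induction l with
  | nil => rfl
  | cons b l ih => simp only [StrCopy.dup, List.flatMap_cons, List.length_append, List.length_cons,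
      List.length_nil] at ih ⊢; omega

/-- Length of the code of the laid-out string. [folklore] -/
theorem length_code_layStr (cs : List (List Lit)) : (codeStr (layStr cs)).length = 5 * (litsLen cs + 3) := by
  rw [length_codeStr, length_layStr]

/-- Length of the doubled code of the laid-out string. [folklore] -/
theorem length_dup_code_layStr (cs : List (List Lit)) :
    (StrCopy.dup (codeStr (layStr cs))).length = 10 * (litsLen cs + 3) := by
  rw [length_dup, length_code_layStr]; ring

/-- Length of the end-marked code of the laid-out string. [folklore] -/
theorem length_boolPair_code_layStr (cs : List (List Lit)) :
    (boolPair (codeStr (layStr cs)) []).length = 10 * (litsLen cs + 3) + 2 := by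
  rw [length_boolPair, length_code_layStr, List.length_nil]; ring

/-- Length of the clocked, end-marked code of the laid-out string. [folklore] -/
theorem length_hdr_code_layStr (cs : List (List Lit)) :
    (hdr (5 * (litsLen cs + 3)) ((5 * (litsLen cs + 3)) ^ 2) (boolPair (codeStr (layStr cs)) [])).length =
      5 * (litsLen cs + 3) + (5 * (litsLen cs + 3)) ^ 2 + (10 * (litsLen cs + 3) + 2) + 2 := by
  rw [length_hdr, length_boolPair_code_layStr]

/-- The evaluation transducer on the final layout outputs whether some assignment of the list
makes the clause list true. [folklore] -/
theorem ev_eval_canon (ρs : List Assg) (cs : List (List Lit)) :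
    evFST.eval (plainStrF .done (ρs.map fun ρ => bodyStr (canon ρ cs))) = [ρs.any fun ρ => evalA ρ cs] := by
  have h : (ρs.map fun ρ => bodyStr (canon ρ cs)) = (ρs.map fun ρ => canon ρ cs).map bodyStr := by simp
  rw [h, ev_eval]
  simp [List.any_map, Function.comp_def, bodyVal_canon]

/-- The number of rounds run, `(5 (litsLen + 3))²`, suffices for the search. [folklore] -/
theorem rounds_le (cs : List (List Lit)) :
    (vars cs).card * (2 * litsLen cs + 3) ≤ (5 * (litsLen cs + 3)) ^ 2 := by
  have h1 : (vars cs).card ≤ litsLen cs := card_vars_le_litsLen cs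
  have h2 := Nat.mul_le_mul_right (2 * litsLen cs + 3) h1
  nlinarith

/-! ### Assembly: k-SAT in time `2^n · poly(L)` -/

/-- **Exhaustive search decides k-SAT in time `2^n · poly(L)`** on Mathlib's `TM2` model: for
every `k`, `KSATInExpTime k 1`. The machine is the sequential composite (additive running
time, `Turing.TM2ComputableAux.comp_outputsWithin`) of the layout transducer, the coding
transducer, the end-marking and clock stages `rePair`, `evalHdrFn (X^2)` of the `FP` toolkit,
the unpacking transducer, the loop machine of the round transducer run for `(5 (litsLen + 3))²`
rounds (`TM2Iter.iterAux_outputsWithin_of_le` with the size bound of `search_initStr`), and the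
evaluation transducer; its running time is at most `2^d · timeG L ≤ c · 2^n · (L + 1)^c`.
(Impagliazzo–Paturi 2001, §1, implicit; Lokshtanov–Marx–Saurabh 2011, §2.) [folklore] -/
theorem kSATInExpTime_one_of_search (k : ℕ) : KSATInExpTime k 1 := by
  classical
  -- the machines of the seven stages
  obtain ⟨M₀, h₀⟩ := layFST.timeComputable_eval
  obtain ⟨M₁, h₁⟩ := codeFST.timeComputable_eval
  have hFP₂ : PolyTimeComputable id id rePair := rePair_mem_FP
  obtain ⟨p₂, M₂, h₂⟩ := hFP₂
  have hFP₃ : PolyTimeComputable id id (evalHdrFn (X ^ 2)) := evalHdrFn_mem_FP (X ^ 2)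
  obtain ⟨p₃, M₃, h₃⟩ := hFP₃
  obtain ⟨M₄, h₄⟩ := unFST.timeComputable_eval
  obtain ⟨N, hN⟩ := roundFST.timeComputable_eval
  obtain ⟨M₆, h₆⟩ := evFST.timeComputable_eval
  obtain ⟨pF, hpF⟩ : ∃ pF : Polynomial ℕ, pF = Polynomial.C (roundFST.maxEmit + 1) * X + 3 := ⟨_, rfl⟩
  have hpFe : ∀ n, pF.eval n = (roundFST.maxEmit + 1) * n + 3 := fun n => by
    subst hpF; simp only [eval_add, eval_mul, eval_C, eval_X, eval_ofNat]
  have hF : ∀ a : List Sym, N.OutputsWithin a (F a) (pF.eval a.length) := fun a => by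
    rw [hpFe]; exact hN a
  let M₅ : TM2ComputableAux (Option Sym) Sym := TM2Iter.iterAux N
  let M : TM2ComputableAux Γ' Bool :=
    (((((M₀.comp M₁).comp M₂).comp M₃).comp M₄).comp M₅).comp M₆
  -- the time bound
  obtain ⟨c, hc⟩ := polyBd_timeG layFST.maxEmit codeFST.maxEmit unFST.maxEmit roundFST.maxEmit
    evFST.maxEmit p₂ p₃
  refine ⟨fun n L => c * 2 ^ n * (L + 1) ^ c, ⟨c, fun n L => ?_⟩, M, fun φ => ?_⟩
  · rw [one_mul, Real.rpow_natCast]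
    push_cast
    exact le_rfl
  -- the run on `φ`
  obtain ⟨ρsF, hfin, htot, hcov, hbd⟩ := search_initStr φ.clauses
  have hfinR := hfin _ (rounds_le φ.clauses)
  -- stage by stage
  have s₀ : M₀.OutputsWithin φ.encode (layStr φ.clauses) ((layFST.maxEmit + 1) * φ.encode.length + 3) := by
    rw [← lay_eval' φ]; exact h₀ φ.encode
  have s₁ : M₁.OutputsWithin (layStr φ.clauses) (StrCopy.dup (codeStr (layStr φ.clauses)))
      ((codeFST.maxEmit + 1) * (layStr φ.clauses).length + 3) := by
    rw [← code_eval]; exact h₁ _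
  have s₂ : M₂.OutputsWithin (StrCopy.dup (codeStr (layStr φ.clauses))) (boolPair (codeStr (layStr φ.clauses)) [])
      (p₂.eval (StrCopy.dup (codeStr (layStr φ.clauses))).length) := by
    rw [← StrCopy.rePair_dup]; exact h₂ _
  have s₃ : M₃.OutputsWithin (boolPair (codeStr (layStr φ.clauses)) [])
      (hdr (5 * (litsLen φ.clauses + 3)) ((5 * (litsLen φ.clauses + 3)) ^ 2) (boolPair (codeStr (layStr φ.clauses)) []))
      (p₃.eval (boolPair (codeStr (layStr φ.clauses)) []).length) := by
    have := h₃ (boolPair (codeStr (layStr φ.clauses)) [])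
    simp only [id, evalHdrFn, boolUnpair_boolPair, eval_pow, eval_X, length_code_layStr] at this
    exact this
  have s₄ : M₄.OutputsWithin
      (hdr (5 * (litsLen φ.clauses + 3)) ((5 * (litsLen φ.clauses + 3)) ^ 2) (boolPair (codeStr (layStr φ.clauses)) []))
      (List.replicate ((5 * (litsLen φ.clauses + 3)) ^ 2) none ++ (initStr φ.clauses).map some)
      ((unFST.maxEmit + 1) *
        (hdr (5 * (litsLen φ.clauses + 3)) ((5 * (litsLen φ.clauses + 3)) ^ 2) (boolPair (codeStr (layStr φ.clauses)) [])).length + 3) := by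
    rw [← layStr_append, ← un_eval]; exact h₄ _
  have s₅ : M₅.OutputsWithin (List.replicate ((5 * (litsLen φ.clauses + 3)) ^ 2) none ++ (initStr φ.clauses).map some)
      (F^[(5 * (litsLen φ.clauses + 3)) ^ 2] (initStr φ.clauses))
      (2 * (initStr φ.clauses).length + (5 * (litsLen φ.clauses + 3)) ^ 2 + 4 + (5 * (litsLen φ.clauses + 3)) ^ 2 *
        (2 * (2 + 2 ^ (vars φ.clauses).card * (3 * litsLen φ.clauses + 4)) + 3 +
          pF.eval (2 + 2 ^ (vars φ.clauses).card * (3 * litsLen φ.clauses + 4)))) :=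
    TM2Iter.iterAux_outputsWithin_of_le (ea := fun l : List Sym => l) N pF hF (initStr φ.clauses) _ _
      (fun i _ => hbd i)
  have s₆ : M₆.OutputsWithin (F^[(5 * (litsLen φ.clauses + 3)) ^ 2] (initStr φ.clauses)) (encodeBool (decide φ.Satisfiable))
      ((evFST.maxEmit + 1) * (F^[(5 * (litsLen φ.clauses + 3)) ^ 2] (initStr φ.clauses)).length + 3) := by
    have := h₆ (F^[(5 * (litsLen φ.clauses + 3)) ^ 2] (initStr φ.clauses))
    rw [hfinR] at this ⊢
    simp only [id, ev_eval_canon] at this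
    have hv : (ρsF.any fun ρ => evalA ρ φ.clauses) = decide φ.Satisfiable := by
      rw [decide_satisfiable_eq φ ρsF hcov htot]
    rw [hv] at this
    exact this
  have H := TM2ComputableAux.comp_outputsWithin _ M₆
    (TM2ComputableAux.comp_outputsWithin _ M₅
      (TM2ComputableAux.comp_outputsWithin _ M₄
        (TM2ComputableAux.comp_outputsWithin _ M₃
          (TM2ComputableAux.comp_outputsWithin _ M₂
            (TM2ComputableAux.comp_outputsWithin M₀ M₁ s₀ s₁) s₂) s₃) s₄) s₅) s₆
  refine H.mono ?_
  -- the arithmetic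
  have key := time_le layFST.maxEmit codeFST.maxEmit unFST.maxEmit roundFST.maxEmit evFST.maxEmit
    p₂ p₃ (litsLen_le_length_encode φ) (hbd ((5 * (litsLen φ.clauses + 3)) ^ 2))
  have hdn : 2 ^ (vars φ.clauses).card ≤ 2 ^ φ.numVars :=
    Nat.pow_le_pow_right (by norm_num) (card_vars_le_numVars φ)
  rw [length_layStr, length_dup_code_layStr, length_boolPair_code_layStr, length_hdr_code_layStr,
    length_initStr, hpFe]
  calc _ ≤ 2 ^ (vars φ.clauses).card * timeG layFST.maxEmit codeFST.maxEmit unFST.maxEmit roundFST.maxEmit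
        evFST.maxEmit p₂ p₃ φ.encode.length := key
    _ ≤ 2 ^ φ.numVars * (c * (φ.encode.length + 1) ^ c) := Nat.mul_le_mul hdn (hc _)
    _ = c * 2 ^ φ.numVars * (φ.encode.length + 1) ^ c := by ring

end Literature.Computability.FineGrained.ExhSat
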